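import Mathlib
import Summits.ResolutionOfSingularities.ResolutionOfSingularities.Theorems.WeightedInvariantLocalWeightedDropPolyDescentMinimalityForms

/-!
# `WeightedInvariant.LocalWeightedDrop`, stub S3ρ, line «monic polyhedron descent», piece (ρ-M) part 2: HIRONAKA'S MINIMALITY OF THE
# WELL-PREPARED POLYGON — `PolyDescent.stub_polyMinimality`

Crux item stmt-ResolutionOfSingularities-8899 `LocalWeightedDrop` (route `ResolutionOfSingularities/WeightedInvariant`), engine of the door
`HypersurfaceCentreConstruction` stmt-ResolutionOfSingularities-19897.  [OURS · L1 W4.3, chain w43; hand res-type-013 on res-L1-w43-plan-1's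
DEALS gen 9 #7 (ρ-M) for the line lead res-L1-w43-lead-1: the stub `PolyDescent.stub_polyMinimality` of
`L/res-L1-w43-lead-1/g3/poly_descent_line_v1.lean` (905148e143a15d9b) with its signature VERBATIM.  MODEL: H. Hironaka, *Characteristic
polyhedra of singularities*, J. Math. Kyoto Univ. 7 (1967) («the polygon of a well-prepared presentation is the characteristic polygon
`Δ(f;u) = ⋂_ψ Δ(f;u;y+ψ)`»), Cossart–Jannsen–Saito LNM 2270 Def. 8.13/8.15; every object is OURS (lead-1's `PolyDescent.WellPrepared/Solvable/
vertexCoeff/IsIntegral`, `MonicDescent.IsVertex`, res-type-083's `WildMonic.shift`, stub-7's `WildMonic.newtonSet/wMin/slotWOrd` and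
`wMin_shift_eq_of_lt/_of_gt`); nothing here is a statement of any manuscript.]

STATEMENT (`stub_polyMinimality`).  `k` a field, `0 < d`, `B` WELL-PREPARED (no vertex of the `d!`-scaled Newton set is solvable), `ψ` any
re-centring, `w` any positive weight: for every `P ∈ newtonSet B` there is `Q ∈ newtonSet (shift d B ψ)` with `w·Q ≤ w·P` — re-centring
never raises the least `w`-weight, `Δ(B) ⊆ Δ(shift B ψ) + ℝ²₊`.  (`IsPosT` and `ψ(0) = 0` of the signature are not used; no hypothesis on the
characteristic.)

PROOF.  `m := wMin w B` (finite as soon as the Newton set is non-empty), `G := d!·ord_w ψ`.  `m < G`: the minimum is kept (stub-7's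
`WildMonic.wMin_shift_eq_of_lt`, Perlega Lemma 5.1.1 (2)); `G < m`: the new minimum is `G` (`wMin_shift_eq_of_gt`, 5.1.1 (3)); `G = m = d!·ν`:
`exists_slotWOrd_shift_le_of_wellPrepared` — if every slot of the shift had scaled order `> m`, every critical-level initial form of the shift
would vanish; by part 1's `weightedHomogeneousComponent_shift` these are the slots of `shift d F c` (`F_i = in_{ν(d−i)} B_i`, `c = in_ν ψ ≠ 0`),
so TAYLOR INVERSION (`eq_choose_mul_neg_pow_of_shift_eq_zero`: `(Y+c)^d + Σ F_i (Y+c)^i = Y^d ⇒ F_i = C(d,i)(−c)^{d−i}`) makes the minimal face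
of `B` the face of `(Y − c)^d`; at the exponent `a` of `c` with least `x₂`-exponent (part 1's `coeff_pow_extreme`) the INTEGRAL point `v = d!·a`
lies in the Newton set (slot `0`, coefficient `(−μ)^d`), is the UNIQUE minimiser of the positive weight `((v₂+1)w₀, (v₂+1)w₁ + 1)` — a VERTEX
(`MonicDescent.IsVertex`) — and has vertex polynomial `Σ_j C(d,j)(−μ)^{d−j} Y^j`, i.e. is SOLVABLE: contradiction with `WellPrepared`.
-/

set_option linter.dupNamespace false -- mandated namespace of this single-conjunct summit

namespace Summit.ResolutionOfSingularities.ResolutionOfSingularities.Theorems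

namespace PolyDescent

open MvPowerSeries MonicDescent WildMonic

variable {k : Type} [Field k]

/-! ## Taylor inversion -/

/-- **TAYLOR INVERSION**: if every slot of the shifted tuple `shift d F c` vanishes, i.e. `(Y + c)^d + Σ F_i (Y + c)^i = Y^d`,
then `Y^d + Σ F_i Y^i = (Y − c)^d`, so `F_i = C(d,i)·(−c)^{d−i}`. [folklore] -/
theorem eq_choose_mul_neg_pow_of_shift_eq_zero {R : Type*} [CommRing R] [Nontrivial R] {d : ℕ} (F : Fin d → R) (c : R)
    (h : ∀ j : Fin d, shift d F c j = 0) (i : Fin d) :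
    F i = (d.choose (i : ℕ) : R) * (-c) ^ (d - (i : ℕ)) := by
  have hs : shift d F c = fun _ => 0 := funext h
  have htaylor : Polynomial.taylor c (monicPoly d F) = Polynomial.X ^ d := by
    rw [taylor_monicPoly, hs]
    simp [monicPoly]
  have hP : monicPoly d F = (Polynomial.X + Polynomial.C (-c)) ^ d := by
    have h2 := congrArg (Polynomial.taylor (-c)) htaylor
    rwa [Polynomial.taylor_taylor, neg_add_cancel, Polynomial.taylor_zero, Polynomial.taylor_pow, Polynomial.taylor_X] at h2
  have h3 : (monicPoly d F).coeff (i : ℕ) = ((Polynomial.X + Polynomial.C (-c)) ^ d).coeff (i : ℕ) := by rw [hP]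
  rwa [coeff_monicPoly_of_lt, Polynomial.coeff_X_add_C_pow, mul_comm] at h3

/-! ## The weight making the extreme point of the minimal face the unique minimiser -/

/-- The perturbed weight `w' = (M·w₀, M·w₁ + 1)`. -/
theorem weight_perturb (w : Fin 2 → ℕ) (M : ℕ) (Q : Fin 2 →₀ ℕ) :
    Finsupp.weight (fun i : Fin 2 => M * w i + if i = 1 then 1 else 0) Q = M * Finsupp.weight w Q + Q 1 := by
  rw [weight_fin_two, weight_fin_two, if_neg (show (0 : Fin 2) ≠ 1 by decide), if_pos rfl]
  ring

/-! ## The equal case `d!·ord_w ψ = m` for a WELL-PREPARED tuple -/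

section EqualCase

variable (w : Fin 2 → ℕ) {d : ℕ} (B : Fin d → MvPowerSeries (Fin 2) k) (ψ : MvPowerSeries (Fin 2) k) (ν : ℕ)

/-- The scaled identity `d!·n = (d!/(d−j)) · ((d−j)·n)`. -/
theorem factorial_mul_eq_slotWeight_mul (j : Fin d) (n : ℕ) : d.factorial * n = slotWeight d j * ((d - (j : ℕ)) * n) := by
  rw [← mul_assoc, slotWeight_mul_sub]

/-- `(d!/(d−j)) • ((d−j) • a) = d! • a`. -/
theorem slotWeight_smul_sub_smul (j : Fin d) (a : Fin 2 →₀ ℕ) : slotWeight d j • ((d - (j : ℕ)) • a) = d.factorial • a := by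
  rw [smul_smul, slotWeight_mul_sub]

/-- **THE EQUAL CASE**: `w` positive, `B` WELL-PREPARED, `m = wMin w B = d!·ν` with `ν = ord_w ψ`. Then some slot of the re-centred
tuple `shift d B ψ` still has scaled order `≤ m`.  Otherwise every critical-level initial form of the shift vanishes, Taylor inversion
gives `in_{ν(d−i)}(B_i) = C(d,i)(−c)^{d−i}` (`c = in_ν ψ ≠ 0`), and for the exponent `a` of `c` with least `x₂`-exponent the integral
point `v = d!·a` lies in the scaled Newton set (slot `0`, coefficient `(−μ)^d ≠ 0`), is its UNIQUE minimiser for the weight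
`((v₂+1)w₀, (v₂+1)w₁ + 1)` — a VERTEX — and has vertex polynomial `Σ C(d,j)(−μ)^{d−j} Y^j = (Y − μ)^d`: a SOLVABLE vertex,
contradicting well-preparedness. [OURS · (ρ-M); Hironaka 1967 (characteristic polyhedron), CJS LNM 2270 Def. 8.13/8.15] -/
theorem exists_slotWOrd_shift_le_of_wellPrepared (hw : ∀ i, 0 < w i) (hd : 0 < d) (hWP : WellPrepared d B)
    (hν : ψ.weightedOrder w = ν) (hm : wMin w B = (d.factorial : ℕ∞) * ν) :
    ∃ j : Fin d, slotWOrd w (shift d B ψ) j ≤ wMin w B := by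
  classical
  by_contra hall
  push Not at hall
  -- the initial forms
  set F : Fin d → MvPowerSeries (Fin 2) k := fun i => weightedHomogeneousComponent w (ν * (d - (i : ℕ))) (B i) with hFdef
  set c : MvPowerSeries (Fin 2) k := weightedHomogeneousComponent w ν ψ with hcdef
  have hB := le_weightedOrder_of_wMin_eq w B ν hm
  -- every slot of the shifted initial forms vanishes
  have hzero : ∀ j : Fin d, shift d F c j = 0 := fun j => by
    rw [hFdef, hcdef, ← weightedHomogeneousComponent_shift w B ψ ν hν hB j]
    apply weightedHomogeneousComponent_of_lt_weightedOrder_eq_zero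
    have h := hall j
    unfold slotWOrd at h
    rw [hm, ← Nat.cast_mul, factorial_mul_eq_slotWeight_mul j, Nat.cast_mul, mul_comm (d - (j : ℕ)) ν] at h
    exact lt_of_slotWeight_mul_lt j h
  have hFi : ∀ i : Fin d, F i = ((d.choose (i : ℕ) : ℕ) : MvPowerSeries (Fin 2) k) * (-c) ^ (d - (i : ℕ)) := fun i =>
    eq_choose_mul_neg_pow_of_shift_eq_zero F c hzero i
  -- `c ≠ 0`, homogeneous; its negative too
  have hc0 : c ≠ 0 := weightedHomogeneousComponent_of_weightedOrder hν.symm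
  have hhom : IsWeightedHomogeneous w c ν := isWeightedHomogeneous_weightedHomogeneousComponent w ψ ν
  have hnc0 : -c ≠ 0 := neg_ne_zero.mpr hc0
  have hnhom : IsWeightedHomogeneous w (-c) ν := fun {e} he => hhom (by rwa [map_neg, neg_ne_zero] at he)
  obtain ⟨a, ha, hmin⟩ := exists_extreme_coeff hnc0
  have hwa : Finsupp.weight w a = ν := hnhom ha
  -- the coefficients of `B` at the points `(d−j)·a`
  have hcoeffF : ∀ (j : Fin d) (e : Fin 2 →₀ ℕ), Finsupp.weight w e = ν * (d - (j : ℕ)) → coeff e (B j) = coeff e (F j) :=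
    fun j e he => by rw [hFdef]; dsimp only; rw [coeff_weightedHomogeneousComponent, if_pos he]
  have hcoeffB : ∀ j : Fin d, coeff ((d - (j : ℕ)) • a) (B j) =
      ((d.choose (j : ℕ) : ℕ) : k) * (coeff a (-c)) ^ (d - (j : ℕ)) := fun j => by
    rw [hcoeffF j _ (by rw [weight_smul, hwa, mul_comm]), hFi j, ← map_natCast (C : k →+* MvPowerSeries (Fin 2) k),
      coeff_C_mul, (coeff_pow_extreme w (hw 0) hnhom ha hmin _).1]
  -- the point `v = d!·a`
  set v : Fin 2 →₀ ℕ := d.factorial • a with hvdef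
  have hcoeff0 : coeff ((d - ((⟨0, hd⟩ : Fin d) : ℕ)) • a) (B ⟨0, hd⟩) ≠ 0 := by
    rw [hcoeffB]
    simp only [Nat.sub_zero, Nat.choose_zero_right, Nat.cast_one, one_mul]
    exact pow_ne_zero _ ha
  have hv_mem : v ∈ newtonSet B := ⟨⟨0, hd⟩, (d - ((⟨0, hd⟩ : Fin d) : ℕ)) • a, hcoeff0, (slotWeight_smul_sub_smul _ a).symm⟩
  have hvc : ∀ j : Fin d, vertexCoeff d B v j = ((d.choose (j : ℕ) : ℕ) : k) * (coeff a (-c)) ^ (d - (j : ℕ)) := fun j => by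
    rw [hvdef, ← slotWeight_smul_sub_smul j a, vertexCoeff_smul, hcoeffB j]
  have hint : IsIntegral d v := fun i => ⟨a i, by rw [hvdef, Finsupp.smul_apply, smul_eq_mul]⟩
  have hsolv : Solvable d B v := ⟨hint, coeff a (-c), hvc⟩
  -- `v` is a vertex: unique minimiser of the perturbed weight
  have hwv : Finsupp.weight w v = d.factorial * ν := by rw [hvdef, weight_smul, hwa]
  have hmnat : ∀ Q ∈ newtonSet B, d.factorial * ν ≤ Finsupp.weight w Q := fun Q hQ => by
    have h := wMin_le_weight_of_mem_newtonSet w B hQ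
    rw [hm, ← Nat.cast_mul] at h
    exact_mod_cast h
  have hvert : IsVertex (newtonSet B) v := by
    refine ⟨hv_mem, fun i => (v 1 + 1) * w i + (if i = 1 then 1 else 0), fun i => ?_, fun Q hQ hne => ?_⟩
    · have := hw i; positivity
    rw [weight_perturb, weight_perturb, hwv]
    rcases (hmnat Q hQ).eq_or_lt with heq | hlt
    · -- `Q` on the minimal face: `Q = (d!/(d−j))·e` with `e` an exponent of `(-c)^{d−j}`
      obtain ⟨j, e, he, rfl⟩ := hQ
      have hwe : Finsupp.weight w e = ν * (d - (j : ℕ)) := by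
        rw [weight_smul, factorial_mul_eq_slotWeight_mul j, mul_comm (d - (j : ℕ)) ν] at heq
        exact (Nat.eq_of_mul_eq_mul_left (slotWeight_pos j) heq).symm
      have heF : coeff e ((-c) ^ (d - (j : ℕ))) ≠ 0 := by
        have h1 := he
        rw [hcoeffF j e hwe, hFi j, ← map_natCast (C : k →+* MvPowerSeries (Fin 2) k), coeff_C_mul] at h1
        exact right_ne_zero_of_mul h1
      have hle : (d - (j : ℕ)) * a 1 ≤ e 1 := (coeff_pow_extreme w (hw 0) hnhom ha hmin _).2 e heF
      have hne1 : e 1 ≠ (d - (j : ℕ)) * a 1 := fun h1 =>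
        hne (by rw [eq_smul_of_coeff_pow_ne_zero w (hw 0) hnhom ha _ heF h1, slotWeight_smul_sub_smul])
      have hlt1 : v 1 < (slotWeight d j • e) 1 := by
        rw [hvdef, Finsupp.smul_apply, Finsupp.smul_apply, smul_eq_mul, smul_eq_mul, factorial_mul_eq_slotWeight_mul j]
        exact Nat.mul_lt_mul_of_pos_left (by omega) (slotWeight_pos j)
      rw [← heq]
      omega
    · have h1 : (v 1 + 1) * (d.factorial * ν + 1) ≤ (v 1 + 1) * Finsupp.weight w Q := Nat.mul_le_mul_left _ hlt
      rw [Nat.mul_succ] at h1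
      omega
  exact hWP v hvert hsolv

end EqualCase

/-! ## (ρ-M): the minimality of the well-prepared polygon -/

/-- **(ρ-M) HIRONAKA'S MINIMALITY OF THE WELL-PREPARED POLYGON** (the signature of `L/res-L1-w43-lead-1/g3/poly_descent_line_v1.lean`
VERBATIM): for a well-prepared position `B` and any re-centring `ψ`, every positive weight attains on `newtonSet (shift d B ψ)` a value
`≤` its minimum on `newtonSet B`.  Trichotomy of `m = wMin w B` against `G = d!·ord_w ψ`: `m < G` keeps `m` (stub-7's
`wMin_shift_eq_of_lt`, Perlega 5.1.1 (2)); `G < m` makes the new minimum `G` (`wMin_shift_eq_of_gt`, 5.1.1 (3)); `G = m` is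
`exists_slotWOrd_shift_le_of_wellPrepared`.  Characteristic-free; `IsPosT` and `ψ(0) = 0` are not used. [OURS · (ρ-M)] -/
theorem stub_polyMinimality : ∀ (k : Type) [Field k] (d : ℕ), 0 < d → ∀ (B : Fin d → MvPowerSeries (Fin 2) k) (ψ : MvPowerSeries (Fin 2) k),
    WellPrepared d B → IsPosT d B → constantCoeff ψ = 0 →
    ∀ w : Fin 2 → ℕ, (∀ i, 0 < w i) → ∀ P ∈ newtonSet B, ∃ Q ∈ newtonSet (shift d B ψ), Finsupp.weight w Q ≤ Finsupp.weight w P := by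
  intro k _ d hd B ψ hWP _ _ w hw P hP
  have hm : wMin w B ≠ ⊤ := wMin_ne_top_of_mem_newtonSet w B hP
  have hmP := wMin_le_weight_of_mem_newtonSet w B hP
  -- a slot of the re-centred tuple of scaled order `≤ m`
  have hslot : ∃ j : Fin d, slotWOrd w (shift d B ψ) j ≤ wMin w B := by
    rcases lt_trichotomy (wMin w B) ((d.factorial : ℕ∞) * ψ.weightedOrder w) with hlt | heq | hgt
    · obtain ⟨j, hj⟩ := exists_slotWOrd_eq_wMin w (shift d B ψ) hd
      exact ⟨j, by rw [hj, wMin_shift_eq_of_lt w B ψ hlt]⟩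
    · have hfin : ψ.weightedOrder w ≠ ⊤ := fun h => hm (by
        rw [heq, h, ENat.mul_top (by exact_mod_cast (Nat.factorial_pos d).ne')])
      obtain ⟨ν, hν⟩ := ENat.ne_top_iff_exists.mp hfin
      exact exists_slotWOrd_shift_le_of_wellPrepared w B ψ ν hw hd hWP hν.symm (by rw [heq, hν])
    · obtain ⟨j, hj⟩ := exists_slotWOrd_eq_wMin w (shift d B ψ) hd
      exact ⟨j, by rw [hj, wMin_shift_eq_of_gt w B ψ hd hgt]; exact hgt.le⟩
  obtain ⟨j, hj⟩ := hslot
  obtain ⟨Q, hQ, hQm⟩ := exists_mem_newtonSet_weight_le w (shift d B ψ) hm j hj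
  exact ⟨Q, hQ, by exact_mod_cast hQm.trans hmP⟩

end PolyDescent

end Summit.ResolutionOfSingularities.ResolutionOfSingularities.Theorems
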